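import Literature.AnabelianGeometry.EtaleTheta.TemperedFrobenioidOfThetaTwistTowerSubgroup
import Literature.AlgebraicGeometry.Frobenioids.QuasiTemperoidInductionFunctor

/-! 
# [EtTh] E2 (a) root law and A10 `BaseRootLaw «Galois»` for the ε-free `(β)` theta tower RESTRICTED TO A TEMPERED SUBGROUP `G ≤ Compat₃′`
# — modulo the displayed level-exhaustion clause (LEV) (Def. 3.3 (iii) p.299, Prop. 4.2 (iii) p.315 / PDF pp.73, 89)

S. Mochizuki, *The étale theta function …*, Publ. RIMS **45** (2009) [MochizukiEtTh2009], Def. 3.3 (i)–(iii) pp.298–300 (PDF pp.72–74), Prop. 4.2 (iii)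
p.315 (PDF p.89) (E2: the tempered-meromorphic root law); S. Mochizuki, *Semi-graphs of anabelioids* (2006), Rmk. 3.1.2 p.33 (`Π/H` connected).
[cite: MochizukiEtTh2009, Prop 4.2 (iii) p.315 (PDF p.89)]  PAGE CONVENTION for [EtTh]: «printed N (PDF p.M)», N = M + 226.

abc-iut cell, layer L2, seat abc-iut-L2-t3 (gen 10; [EtTh] §3/§4 lineage), row «(β2) COMAP-TOWER fourth-model twin» step (β2-B) (abc-iut-L2-lead R1257/R1277).
PROOF-ONLY; ADDITIVE.  Consumed BY NAME: abc-iut-L2-t3's E2 proof pattern `rootLawC₃sf` (p490708: the level-`m` root `r₀` of an ε-free value,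
`fnStabC₃`, `kumLevelC₃`, `resFnC₃_levelActFnMod`, `resFn_upAdd_trans`), abc-iut-L2-t2's comapped tower (p505912/p506639:
`ρ_eq_of_mem_closure_rep_lvl`, `comap_resFn`), abc-iut-L3's `BTemp.quotientObj` / `isConnectedObj_quotientObj` / `exists_hom_quotientObj` /
`quotientObj_ρ_one_eq_iff`, abc-iut-w6-d048/d058's `GaloisAction.exists_bZero_quotient_of_invariant`, abc-iut-L2-t3's small-index kit
`baseRootLaw_galoisObj_precomp_toConnected_of_rootLaw` (p499867), (β2-A) `temperedFrobenioidSub` (p507623).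
* **FINDING (displayed, not hidden) — the level-exhaustion clause (LEV).**  Over `B^temp(G)⁰` a connected tempered `G`-set is read at the least
  level `n` whose trace `Δ_n ∩ G` fixes it; if the traces of `G` do not separate the Kummer levels (e.g. `G` finite, or `G` missing the geometric
  Kummer coordinates) every `G`-set is read at a bounded level and NO covering acquires roots of high order — E2 FAILS for such `G`.  The proof
  below needs exactly (LEV) «`Δ_n ∩ G ⊆ kumLevel_m` forces `m ≤ n`»; it HOLDS for `G = Compat₃′` (`hlev_top`, the elements `natElt`) and for every
  `G` containing the `natElt`s (`hlev_of_natElt_mem`); for `G := closure(Im φ)` of the genuine `φ` it is TRUE IN SHAPE (the Kummer class of `Θ̈`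
  restricted to `Δ_Θ ≅ Ẑ(1)` exhausts every level) but is a DISPLAYED HYPOTHESIS here — the honest successor of the retired onto-clause.
* **`rootLawSub G hG hlev : (dmG G).RootLaw`** — E2 (a) over `B^temp(G)⁰`: every `b ∈ B₀(Y)` acquires, for every `K ≥ 1`, a `K`-th root over
  the connected tempered `G`-covering `G/(Stab_G(y₀) ∩ (kumLevel_{n+K} ∩ Stab(r₀)) ∩ G)`, read at its level `≥ n + K` by (LEV).
* `rootLawSubSmall` (re-indexed over `CosetCat G`, abc-iut-L2-t3's `RootLaw.precomp_of_full_essSurj`) and **A10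
  `baseRootLaw_galois_temperedFrobenioidSub G hG hlev R S : (temperedFrobenioidSub G hG R S).BaseRootLaw «A Galois»`**.
HONEST FRAMING: class-(b) combinatorial design carrier (NOT the tempered Frobenioid of a Tate curve); (LEV) displayed; [EtTh]/[SemiAnbd] are refereed
prerequisite papers; nothing here bears on, or takes a side on, the disputed [IUTchIII] Cor. 3.12; nothing here asserts abc proved or refuted; typed ≠ proved.
-/

noncomputable section

namespace Literature.AnabelianGeometry.EtaleTheta

open CategoryTheory Opposite Function Literature.AlgebraicGeometry.Frobenioids Literature.AnabelianGeometry.SemiGraphs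
  Literature.AnabelianGeometry.SemiGraphs.GaloisObjects Literature.AlgebraicGeometry.Frobenioids.QuasiTemperoid
  LogDivisorModel LogDivisorModel.GaloisAction LogDivisorTower TateTowerKummerTwistRShear LogDivisorModel.TateTowerThetaTwist

namespace ThetaTwistTowerSubgroup

open ThetaTwistTowerTempered TateTowerTheta
open TateTowerKummerTwist (M N coe_N N_dvd_M N_dvd_N eN N_mul_eN eN_pos upAdd upAdd_trans)

variable (G : Subgroup (Compat 3 thetaShear))

/-! ## §1 The level-exhaustion clause (LEV) -/

/-- **(LEV) holds for `G := Compat₃′` itself**: `Δ_n ⊆ kumLevel_m` forces `m ≤ n` (the element `natElt n`). [cite: MochizukiEtTh2009, Def 3.3 (i) p.298 (PDF p.72)] -/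
theorem hlev_of_natElt_mem (hG' : ∀ j : ℕ, natElt 3 thetaShear j ∈ G) (n m : ℕ)
    (h : ∀ g : G, (g : Compat 3 thetaShear) ∈ closureC 3 thetaShear n → (g : Compat 3 thetaShear) ∈ kumLevelC₃ m) : m ≤ n :=
  (natElt_mem_kumLevelC₃_iff n m).1 (h ⟨natElt 3 thetaShear n, hG' n⟩ ((natElt_mem_closureC_iff 3 thetaShear n n).2 le_rfl))

/-- (LEV) for the whole group. [cite: MochizukiEtTh2009, Def 3.3 (i) p.298 (PDF p.72)] -/
theorem hlev_top (n m : ℕ)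
    (h : ∀ g : (⊤ : Subgroup (Compat 3 thetaShear)), (g : Compat 3 thetaShear) ∈ closureC 3 thetaShear n →
      (g : Compat 3 thetaShear) ∈ kumLevelC₃ m) : m ≤ n :=
  hlev_of_natElt_mem ⊤ (fun _ => Subgroup.mem_top _) n m h

/-! ## §2 E2 (a) over `B^temp(G)⁰` modulo (LEV) -/

set_option maxHeartbeats 400000 in
/-- **E2 (a) — the ROOT LAW over `B^temp(G)⁰` for a tempered subgroup `G ≤ Compat₃′` satisfying (LEV)**: every `b ∈ B₀(Y)` (reading level
`n = lvlG Y`) acquires, for every `K ≥ 1`, a `K`-th root over the connected tempered `G`-covering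
`Y′ = G/(Stab_G(y₀) ∩ G ∩ (kumLevel_{n+K} ∩ Stab(r₀)))` at the reading level `l′ ≥ n + K` of `Y′` — abc-iut-L2-t3's `rootLawC₃sf` argument, the
group `Compat₃′` replaced by `G` acting through the inclusion. [cite: MochizukiEtTh2009, Prop 4.2 (iii) p.315 (PDF p.89)] -/
theorem rootLawSub (hG : IsTempered G)
    (hlev : ∀ n m : ℕ, (∀ g : G, (g : Compat 3 thetaShear) ∈ closureC 3 thetaShear n → (g : Compat 3 thetaShear) ∈ kumLevelC₃ m) → m ≤ n) :
    (dmG G).RootLaw := by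
  rw [LogDivisorTower.rootLaw_ofTower_iff]
  intro K Y b
  obtain ⟨y₀⟩ := BTempConnected.nonempty_of_isConnectedObj Y.obj Y.property
  -- the reading level `n` of `Y`, the target level `m = n + K`, `eN n m = K q`
  obtain ⟨q, hq⟩ : (K : ℕ) ∣ eN (lvlG G Y) (lvlG G Y + (K : ℕ)) := by
    have h1 : (lvlG G Y + 1).factorial * (K : ℕ).factorial ∣ (lvlG G Y + 1 + (K : ℕ)).factorial :=
      Nat.factorial_mul_factorial_dvd_factorial_add _ _
    have h2 : (lvlG G Y + 1).factorial * eN (lvlG G Y) (lvlG G Y + (K : ℕ)) = (lvlG G Y + 1 + (K : ℕ)).factorial := by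
      have h3 := N_mul_eN (Nat.le_add_right (lvlG G Y) (K : ℕ))
      rw [coe_N, coe_N, Nat.add_right_comm] at h3
      exact h3
    rw [← h2] at h1
    exact (Nat.dvd_factorial K.pos le_rfl).trans ((Nat.mul_dvd_mul_iff_left (Nat.factorial_pos _)).mp h1)
  have hnm : lvlG G Y ≤ lvlG G Y + (K : ℕ) := Nat.le_add_right _ _
  -- the value at `y₀` (ε-free) and its level-`m` `K`-th root
  let x₀ : (towerC₃sf.Z (lvlG G Y)).Fn := b.1 y₀
  let r₀ : Fn (Mu₃ (lvlG G Y + (K : ℕ))) :=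
    (Multiplicative.ofAdd (((q * (Multiplicative.toAdd x₀.1.1).val : ℕ)) : ZMod (N (lvlG G Y + (K : ℕ)))),
      Multiplicative.ofAdd (((0 : ZMod 2), (q : ℤ) * eC (Multiplicative.toAdd x₀.1.2), (q : ℤ) * eU (Multiplicative.toAdd x₀.1.2),
        (q : ℤ) * eT (Multiplicative.toAdd x₀.1.2)) : Exp))
  have hr₀mem : r₀ ∈ epsKer (ZMod (N (lvlG G Y + (K : ℕ)))) := rfl
  have hr₀ : r₀ ^ (K : ℕ) = resFn (upAdd hnm) (eN (lvlG G Y) (lvlG G Y + (K : ℕ))) x₀.1 := by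
    refine Prod.ext (Multiplicative.toAdd.injective ?_) (Multiplicative.toAdd.injective ?_)
    · change (K : ℕ) • (((q * (Multiplicative.toAdd x₀.1.1).val : ℕ)) : ZMod (N (lvlG G Y + (K : ℕ)))) =
        upAdd hnm (Multiplicative.toAdd x₀.1.1)
      conv_rhs => rw [← ZMod.natCast_zmod_val (Multiplicative.toAdd x₀.1.1), ← Int.cast_natCast, TateTowerKummerTwist.upAdd_intCast,
        Int.cast_natCast, ← Nat.cast_mul]
      rw [nsmul_eq_mul, ← Nat.cast_mul, ← mul_assoc, ← hq, Nat.mul_comm]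
    · change (K : ℕ) • (((0 : ZMod 2), (q : ℤ) * eC (Multiplicative.toAdd x₀.1.2), (q : ℤ) * eU (Multiplicative.toAdd x₀.1.2),
          (q : ℤ) * eT (Multiplicative.toAdd x₀.1.2)) : Exp) =
        resExp (eN (lvlG G Y) (lvlG G Y + (K : ℕ))) (Multiplicative.toAdd x₀.1.2)
      have hx' : (Multiplicative.toAdd x₀.1.2).1 = 0 := x₀.2
      refine ext_exp ?_ ?_ ?_ ?_
      · rw [Prod.smul_fst, smul_zero]
        exact hx'.symm
      · rw [eC_resExp, hq, Nat.cast_mul]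
        change (K : ℕ) • ((q : ℤ) * eC (Multiplicative.toAdd x₀.1.2)) = _
        rw [nsmul_eq_mul]; ring
      · rw [eU_resExp, hq, Nat.cast_mul]
        change (K : ℕ) • ((q : ℤ) * eU (Multiplicative.toAdd x₀.1.2)) = _
        rw [nsmul_eq_mul]; ring
      · rw [eT_resExp, hq, Nat.cast_mul]
        change (K : ℕ) • ((q : ℤ) * eT (Multiplicative.toAdd x₀.1.2)) = _
        rw [nsmul_eq_mul]; ring
  -- the cover `Y′ = G/H`
  let H : Subgroup G := stabilizerSubgroup Y.obj y₀ ⊓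
    (kumLevelC₃ (lvlG G Y + (K : ℕ)) ⊓ fnStabC₃ (lvlG G Y + (K : ℕ)) r₀).comap G.subtype
  have hH : IsOpen (H : Set G) :=
    (isOpen_stabilizerSubgroup Y.obj y₀).inter
      (((isOpen_kumLevelC₃ _).inter (isOpen_fnStabC₃ _ r₀)).preimage continuous_subtype_val)
  let Y' : ConnectedPart (BTemp G) := ⟨BTemp.quotientObj G hG H hH, isConnectedObj_quotientObj hG H hH⟩
  -- the covering map `Y′ → Y`, `[g] ↦ g · y₀` (via `choose`: destructuring `obtain` over the `let`-bound cover is too slow here)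
  have hfix : ∀ k ∈ H, Y.obj.obj.ρ k y₀ = y₀ := fun k hk => mem_stabilizerSubgroup_iff.mp (Subgroup.mem_inf.mp hk).1
  have hex := exists_hom_quotientObj hG H hH (X := Y.obj) y₀ hfix
  have hf₀ : (hex.choose.hom.hom ((1 : G) : G ⧸ H) : Y.obj.obj.V) = y₀ := hex.choose_spec
  let f : Y' ⟶ Y := ObjectProperty.homMk hex.choose
  -- the reading level of `Y′` is at least `m` — HERE (LEV) is used
  have hml : lvlG G Y + (K : ℕ) ≤ lvlG G Y' := by
    refine hlev _ _ fun g hg => ?_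
    have h1 : Y'.obj.obj.ρ g ((1 : G) : G ⧸ H) = ((1 : G) : G ⧸ H) := LogDivisorTower.ρ_eq_of_mem_closure_rep_lvl (L := levelsC 3 thetaShear) id heC hbC G Y' hg _
    exact ((quotientObj_ρ_one_eq_iff hG H hH g).1 h1).2.1
  have hnl : lvlG G Y ≤ lvlG G Y' := hnm.trans hml
  -- the root at level `l′`, ε-free, as an equivariant family on `G/H`
  have hmem : resFn (upAdd hml) (eN (lvlG G Y + (K : ℕ)) (lvlG G Y')) r₀ ∈ epsKer (ZMod (N (lvlG G Y'))) :=
    resFn_mem_epsKer _ _ hr₀mem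
  have hexr := ((towerC₃sf.act (lvlG G Y')).comap G.subtype).exists_bZero_quotient_of_invariant H
    (f := (⟨resFn (upAdd hml) (eN (lvlG G Y + (K : ℕ)) (lvlG G Y')) r₀, hmem⟩ : (towerC₃sf.Z (lvlG G Y')).Fn)) trivial
    (fun h hh => Subtype.ext (by
      change levelActFnMod (lvlG G Y') (N (lvlG G Y')) (N_dvd_M (lvlG G Y')) ((h : Compat 3 thetaShear) : Grp 3 thetaShear)
          (resFn (upAdd hml) (eN (lvlG G Y + (K : ℕ)) (lvlG G Y')) r₀) =
        resFn (upAdd hml) (eN (lvlG G Y + (K : ℕ)) (lvlG G Y')) r₀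
      rw [← resFnC₃_eq, ← resFnC₃_levelActFnMod hml (h : Compat 3 thetaShear) r₀]
      exact congrArg (resFnC₃ hml) hh.2.2))
  let r := hexr.choose
  have hr : r.1 ((1 : G) : G ⧸ H) = _ := hexr.choose_spec
  refine ⟨Y', f, r, Subtype.ext (funext fun s => ?_)⟩
  induction s using QuotientGroup.induction_on with
  | H g =>
    have e1 : (g : G ⧸ H) = Y'.obj.obj.ρ g ((1 : G) : G ⧸ H) := by
      rw [quotientObj_ρ_mk hG H hH g 1, mul_one]
    have hfg : f.hom.hom.hom (g : G ⧸ H) = Y.obj.obj.ρ g y₀ := by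
      have h := BTempConnected.hom_ρ hex.choose g ((1 : G) : G ⧸ H)
      rw [hf₀] at h
      exact (congrArg _ e1).trans h
    have hrg : r.1 (g : G ⧸ H) = (towerC₃sf.act (lvlG G Y')).actFn (g : Compat 3 thetaShear)
        ⟨resFn (upAdd hml) (eN (lvlG G Y + (K : ℕ)) (lvlG G Y')) r₀, hmem⟩ := by
      have h := r.2.2 g ((1 : G) : G ⧸ H)
      rw [hr] at h
      exact (congrArg r.1 e1).trans h
    have hbg : b.1 (Y.obj.obj.ρ g y₀) = (towerC₃sf.act (lvlG G Y)).actFn (g : Compat 3 thetaShear) x₀ := b.2.2 g y₀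
    change r.1 (g : G ⧸ H) ^ (K : ℕ) = towerC₃sf.resFn _ (b.1 (f.hom.hom.hom (g : G ⧸ H)))
    rw [hrg, hfg, hbg]
    refine Subtype.ext ?_
    change levelActFnMod (lvlG G Y') (N (lvlG G Y')) (N_dvd_M (lvlG G Y')) ((g : Compat 3 thetaShear) : Grp 3 thetaShear)
        (resFn (upAdd hml) (eN (lvlG G Y + (K : ℕ)) (lvlG G Y')) r₀) ^ (K : ℕ) =
      resFn (upAdd hnl) (eN (lvlG G Y) (lvlG G Y'))
        (levelActFnMod (lvlG G Y) (N (lvlG G Y)) (N_dvd_M (lvlG G Y)) ((g : Compat 3 thetaShear) : Grp 3 thetaShear) x₀.1)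
    rw [← map_pow, ← map_pow, hr₀, resFn_upAdd_trans hnm hml, ← resFnC₃_eq]
    exact (resFnC₃_levelActFnMod hnl (g : Compat 3 thetaShear) x₀.1).symm

/-! ## §3 Re-indexing over `CosetCat G` and A10 `BaseRootLaw «Galois»` -/

variable (hG : IsTempered G)

/-- E2 (a) survives the re-indexing over the small coset model (abc-iut-L2-t3's `RootLaw.precomp_of_full_essSurj`, p499867).
[cite: MochizukiEtTh2009, Prop 4.2 (iii) p.315 (PDF p.89)] -/
theorem rootLawSubSmall
    (hlev : ∀ n m : ℕ, (∀ g : G, (g : Compat 3 thetaShear) ∈ closureC 3 thetaShear n → (g : Compat 3 thetaShear) ∈ kumLevelC₃ m) → m ≤ n) :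
    (dmSubSmall G hG).RootLaw := by
  haveI := CosetCat.toConnected_full hG
  haveI := CosetCat.toConnected_essSurj hG
  exact (rootLawSub G hG hlev).precomp_of_full_essSurj (dmG G) _

variable (R S : ((ConnectedPart (BTemp G))ᵒᵖ ⥤ CommMonCat.{0}) → Prop)

/-- **A10 `BaseRootLaw «Galois»` for the tower model over `B^temp(G)⁰`** (modulo (LEV)): from E2 (a) through abc-iut-L2-t3's small-index kit.
[cite: MochizukiEtTh2009, Prop 4.2 (iii) p.315 (PDF p.89)] -/
theorem baseRootLaw_galois_temperedFrobenioidSub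
    (hlev : ∀ n m : ℕ, (∀ g : G, (g : Compat 3 thetaShear) ∈ closureC 3 thetaShear n → (g : Compat 3 thetaShear) ∈ kumLevelC₃ m) → m ≤ n) :
    (temperedFrobenioidSub G hG R S).BaseRootLaw fun A => IsGaloisObj A.obj :=
  TemperedFrobenioid.baseRootLaw_galoisObj_precomp_toConnected_of_rootLaw hG _ rfl (rootLawSub G hG hlev)

end ThetaTwistTowerSubgroup

end Literature.AnabelianGeometry.EtaleTheta

end
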